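import Mathlib.Analysis.CStarAlgebra.Matrix
import Mathlib.Analysis.CStarAlgebra.Spectrum
import Mathlib.Analysis.CStarAlgebra.ContinuousLinearMap
import Mathlib.Analysis.CStarAlgebra.ContinuousFunctionalCalculus.Basic
import Mathlib.Analysis.CStarAlgebra.ContinuousFunctionalCalculus.Instances
import Mathlib.Analysis.CStarAlgebra.ContinuousFunctionalCalculus.Isometric
import Mathlib.Analysis.Complex.Polynomial.Basic
import Mathlib.LinearAlgebra.Matrix.Charpoly.Eigs
import HarnessLib

/-!
# Resonance bound for unitaries: `dist(1, σ(V)) · ‖x‖ ≤ ‖x − V x‖`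

Topic `Literature/Analysis/InnerProduct`; support file (all proved; no definitions; no named facts).

A unitary operator that almost fixes a vector has a spectral value near `1`: for a unitary `T` on a
complex Hilbert space and `x ∈ E`, `dist(1, σ(T)) · ‖x‖ ≤ ‖x − T x‖` — because `T` is normal, so
`‖(1 − T)⁻¹‖ = sup_{z ∈ σ(T)} |1 − z|⁻¹ = 1/dist(1, σ(T))`.  Stated DEF-FREE (no `dist` to a set):

* `unitary_sep_mul_norm_le_norm_sub` — operator form: if `d ≤ ‖1 − z‖` for every `z ∈ σ(T)` then
  `d · ‖x‖ ≤ ‖x − T x‖` (continuous functional calculus for the star-normal element `T` of the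
  C⋆-algebra `E →L[ℂ] E`, applied to `z ↦ (1 − z)⁻¹`).
* `toEuclideanCLM_mem_unitary` — the star-algebra equivalence `Matrix.toEuclideanCLM` maps unitary
  matrices to unitary operators.
* `unitary_exists_root_charpoly_norm_mul_le` — matrix form on `EuclideanSpace ℂ n` with the roots of the
  characteristic polynomial as the spectrum: some root `z` of `χ_V` has `‖1 − z‖ · ‖x‖ ≤ ‖x − V x‖`.

Used by the QuantumFields/QCD line `corner-decorrelation-deep-hole` ("a bad site forces a resonant
plaquette": `V = R(α) ⊗ U_P` unitary almost fixing the flat section).  Reed–Simon I, Thm. VII.2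
consequences; Kato, *Perturbation theory*, §V.3.5 (`‖R(ζ)‖ = 1/dist(ζ, σ)` for normal operators).
Everything here is folklore.
-/

noncomputable section

namespace Literature.Analysis.InnerProduct

open scoped Matrix.Norms.L2Operator
open Matrix

/-- **Resonance bound, operator form.**  For a unitary bounded operator `T` on a complex Hilbert space,
if every spectral value `z` satisfies `d ≤ ‖1 − z‖` (some `0 ≤ d`), then `d · ‖x‖ ≤ ‖x − T x‖` for every
vector `x`.  Proof: `T` is star-normal; for `d > 0`, `1 ∉ σ(T)` and `R = f(T)`, `f(z) = (1 − z)⁻¹`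
(continuous functional calculus) satisfies `R (1 − T) = 1` and `‖R‖ ≤ d⁻¹`. [folklore] -/
theorem unitary_sep_mul_norm_le_norm_sub {E : Type*} [NormedAddCommGroup E] [InnerProductSpace ℂ E]
    [CompleteSpace E] {T : E →L[ℂ] E} (hT : T ∈ unitary (E →L[ℂ] E)) {d : ℝ} (hd : 0 ≤ d)
    (hsep : ∀ z ∈ spectrum ℂ T, d ≤ ‖1 - z‖) (x : E) :
    d * ‖x‖ ≤ ‖x - T x‖ := by
  rcases hd.eq_or_lt with h0 | hdpos
  · rw [← h0, zero_mul]
    exact norm_nonneg _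
  · haveI : IsStarNormal T := isStarNormal_of_mem_unitary hT
    have h1 : (1 : ℂ) ∉ spectrum ℂ T := by
      intro h
      have h' := hsep 1 h
      rw [sub_self, norm_zero] at h'
      exact absurd h' (not_le.mpr hdpos)
    set f : ℂ → ℂ := fun z => (1 - z)⁻¹ with hf_def
    have hne : ∀ z ∈ spectrum ℂ T, (1 : ℂ) - z ≠ 0 := by
      intro z hz hz0
      have hz1 : z = 1 := (sub_eq_zero.mp hz0).symm
      exact h1 (hz1 ▸ hz)
    have hg : ContinuousOn (fun z : ℂ => 1 - z) (spectrum ℂ T) :=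
      (continuousOn_const.sub continuousOn_id)
    have hf : ContinuousOn f (spectrum ℂ T) := hg.inv₀ hne
    -- `(1 - ·)(T) = 1 - T`
    have hsub : cfc (fun z : ℂ => 1 - z) T = 1 - T := by
      have e : (fun z : ℂ => (1 : ℂ) - z) = fun z => (fun _ : ℂ => (1 : ℂ)) z - id z := rfl
      rw [e, cfc_sub _ _ T, cfc_const_one ℂ T, cfc_id ℂ T]
    -- `f(T) (1 - T) = 1`
    have hmul : cfc f T * (1 - T) = 1 := by
      rw [← hsub, ← cfc_mul f (fun z : ℂ => 1 - z) T hf hg]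
      calc cfc (fun z : ℂ => f z * (1 - z)) T = cfc (fun _ : ℂ => (1 : ℂ)) T := by
            refine cfc_congr fun z hz => ?_
            simp only [hf_def]
            exact inv_mul_cancel₀ (hne z hz)
        _ = 1 := cfc_const_one ℂ T
    have hnorm : ‖cfc f T‖ ≤ d⁻¹ := by
      refine norm_cfc_le (inv_nonneg.mpr hd) fun z hz => ?_
      simp only [hf_def, norm_inv]
      exact inv_anti₀ hdpos (hsep z hz)
    have hx : cfc f T ((1 - T) x) = x := by
      change (cfc f T * (1 - T)) x = x
      rw [hmul]
      rfl
    have hTx : (1 - T) x = x - T x := rfl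
    calc d * ‖x‖ = d * ‖cfc f T ((1 - T) x)‖ := by rw [hx]
      _ ≤ d * (‖cfc f T‖ * ‖(1 - T) x‖) := by
          gcongr
          exact ContinuousLinearMap.le_opNorm _ _
      _ ≤ d * (d⁻¹ * ‖(1 - T) x‖) := by gcongr
      _ = ‖x - T x‖ := by rw [← mul_assoc, mul_inv_cancel₀ hdpos.ne', one_mul, hTx]

variable {n : Type*} [Fintype n] [DecidableEq n]

/-- The star-algebra equivalence `Matrix.toEuclideanCLM` maps unitary matrices to unitary operators on
`EuclideanSpace ℂ n`. [folklore] -/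
theorem toEuclideanCLM_mem_unitary {V : Matrix n n ℂ} (hV : V ∈ Matrix.unitaryGroup n ℂ) :
    toEuclideanCLM (n := n) (𝕜 := ℂ) V ∈ unitary (EuclideanSpace ℂ n →L[ℂ] EuclideanSpace ℂ n) := by
  rw [Unitary.mem_iff]
  constructor
  · rw [← map_star, ← map_mul, Unitary.star_mul_self_of_mem hV, map_one]
  · rw [← map_star, ← map_mul, Unitary.mul_star_self_of_mem hV, map_one]

/-- **Resonance bound, matrix form ("bad site ⇒ resonant plaquette").**  For a unitary complex matrix `V`
on a non-empty index type and every vector `x` of `EuclideanSpace ℂ n`, some root `z` of the characteristic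
polynomial of `V` (an eigenvalue, counted in the root multiset) satisfies `‖1 − z‖ · ‖x‖ ≤ ‖x − V x‖`;
equivalently `dist(1, σ(V)) ≤ ‖x − V x‖ / ‖x‖`. [folklore] -/
theorem unitary_exists_root_charpoly_norm_mul_le [Nonempty n] {V : Matrix n n ℂ}
    (hV : V ∈ Matrix.unitaryGroup n ℂ) (x : EuclideanSpace ℂ n) :
    ∃ z ∈ V.charpoly.roots, ‖(1 : ℂ) - z‖ * ‖x‖ ≤ ‖x - toEuclideanLin V x‖ := by
  classical
  -- the root multiset is non-empty (the characteristic polynomial splits over `ℂ` and has positive degree)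
  have hsplit : V.charpoly.Splits := IsAlgClosed.splits _
  have hcard : Multiset.card V.charpoly.roots = Fintype.card n := by
    rw [← hsplit.natDegree_eq_card_roots, Matrix.charpoly_natDegree_eq_dim]
  have hne : V.charpoly.roots.toFinset.Nonempty := by
    rw [Multiset.toFinset_nonempty, ← Multiset.card_pos, hcard]
    exact Fintype.card_pos
  obtain ⟨z₀, hz₀, hmin⟩ := V.charpoly.roots.toFinset.exists_min_image (fun z => ‖(1 : ℂ) - z‖) hne
  refine ⟨z₀, Multiset.mem_toFinset.mp hz₀, ?_⟩
  -- every spectral value of `toEuclideanCLM V` is a root of `χ_V`, hence no closer to `1` than `z₀`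
  have hspec : spectrum ℂ (toEuclideanCLM (n := n) (𝕜 := ℂ) V) = spectrum ℂ V :=
    AlgEquiv.spectrum_eq _ V
  have hsep : ∀ z ∈ spectrum ℂ (toEuclideanCLM (n := n) (𝕜 := ℂ) V), ‖(1 : ℂ) - z₀‖ ≤ ‖1 - z‖ := by
    intro z hz
    rw [hspec, Matrix.mem_spectrum_iff_isRoot_charpoly] at hz
    refine hmin z (Multiset.mem_toFinset.mpr ?_)
    exact (Polynomial.mem_roots V.charpoly_monic.ne_zero).mpr hz
  have h := unitary_sep_mul_norm_le_norm_sub (toEuclideanCLM_mem_unitary hV) (norm_nonneg _) hsep x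
  -- `toEuclideanCLM V x = toEuclideanLin V x`
  have hcoe : toEuclideanCLM (n := n) (𝕜 := ℂ) V x = toEuclideanLin V x := by
    rw [← coe_toEuclideanCLM_eq_toEuclideanLin]
    rfl
  rwa [hcoe] at h

/-! ## Normal operators: general spectral parameter and spectral variation

* `normal_sep_mul_norm_le_norm_sub`, `normal_exists_root_charpoly_norm_mul_le` — the resonance bound for
  star-normal operators / normal matrices and an arbitrary spectral parameter `μ`
  (`‖(μ − T)⁻¹‖ ≤ 1/dist(μ, σ(T))`).
* `normal_exists_root_charpoly_norm_sub_le` — spectral variation: every eigenvalue of any `W` is within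
  `‖W − V‖` (ℓ² operator norm) of the spectrum of a normal `V` (easy half of Bauer–Fike; Bhatia,
  *Matrix Analysis*, Thm. VI.3.3). -/

/-- **Resonance bound for normal operators.**  For a star-normal bounded operator `T` on a complex Hilbert
space and `μ ∈ ℂ`, if every spectral value `z` satisfies `d ≤ ‖μ − z‖` (some `0 ≤ d`), then
`d · ‖x‖ ≤ ‖μ • x − T x‖` for every vector `x`, i.e. `‖(μ − T)⁻¹‖ ≤ 1/dist(μ, σ(T))` (Kato,
*Perturbation theory for linear operators*, §V.3.5, (3.31)). [folklore] -/
theorem normal_sep_mul_norm_le_norm_sub {E : Type*} [NormedAddCommGroup E] [InnerProductSpace ℂ E]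
    [CompleteSpace E] {T : E →L[ℂ] E} [IsStarNormal T] (μ : ℂ) {d : ℝ} (hd : 0 ≤ d)
    (hsep : ∀ z ∈ spectrum ℂ T, d ≤ ‖μ - z‖) (x : E) :
    d * ‖x‖ ≤ ‖μ • x - T x‖ := by
  rcases hd.eq_or_lt with h0 | hdpos
  · rw [← h0, zero_mul]
    exact norm_nonneg _
  · have h1 : μ ∉ spectrum ℂ T := by
      intro h
      have h' := hsep μ h
      rw [sub_self, norm_zero] at h'
      exact absurd h' (not_le.mpr hdpos)
    set f : ℂ → ℂ := fun z => (μ - z)⁻¹ with hf_def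
    have hne : ∀ z ∈ spectrum ℂ T, μ - z ≠ 0 := by
      intro z hz hz0
      have hz1 : z = μ := (sub_eq_zero.mp hz0).symm
      exact h1 (hz1 ▸ hz)
    have hg : ContinuousOn (fun z : ℂ => μ - z) (spectrum ℂ T) :=
      (continuousOn_const.sub continuousOn_id)
    have hf : ContinuousOn f (spectrum ℂ T) := hg.inv₀ hne
    have hsub : cfc (fun z : ℂ => μ - z) T = μ • (1 : E →L[ℂ] E) - T := by
      have e : (fun z : ℂ => μ - z) = fun z => (fun _ : ℂ => μ) z - id z := rfl
      rw [e, cfc_sub _ _ T, cfc_const μ T, cfc_id ℂ T, Algebra.algebraMap_eq_smul_one]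
    have hmul : cfc f T * (μ • (1 : E →L[ℂ] E) - T) = 1 := by
      rw [← hsub, ← cfc_mul f (fun z : ℂ => μ - z) T hf hg]
      calc cfc (fun z : ℂ => f z * (μ - z)) T = cfc (fun _ : ℂ => (1 : ℂ)) T := by
            refine cfc_congr fun z hz => ?_
            simp only [hf_def]
            exact inv_mul_cancel₀ (hne z hz)
        _ = 1 := cfc_const_one ℂ T
    have hnorm : ‖cfc f T‖ ≤ d⁻¹ := by
      refine norm_cfc_le (inv_nonneg.mpr hd) fun z hz => ?_
      simp only [hf_def, norm_inv]
      exact inv_anti₀ hdpos (hsep z hz)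
    have hx : cfc f T ((μ • (1 : E →L[ℂ] E) - T) x) = x := by
      change (cfc f T * (μ • (1 : E →L[ℂ] E) - T)) x = x
      rw [hmul]
      rfl
    have hTx : (μ • (1 : E →L[ℂ] E) - T) x = μ • x - T x := rfl
    calc d * ‖x‖ = d * ‖cfc f T ((μ • (1 : E →L[ℂ] E) - T) x)‖ := by rw [hx]
      _ ≤ d * (‖cfc f T‖ * ‖(μ • (1 : E →L[ℂ] E) - T) x‖) := by
          gcongr
          exact ContinuousLinearMap.le_opNorm _ _
      _ ≤ d * (d⁻¹ * ‖(μ • (1 : E →L[ℂ] E) - T) x‖) := by gcongr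
      _ = ‖μ • x - T x‖ := by rw [← mul_assoc, mul_inv_cancel₀ hdpos.ne', one_mul, hTx]

/-- `Matrix.toEuclideanCLM` preserves star-normality. [folklore] -/
theorem isStarNormal_toEuclideanCLM {V : Matrix n n ℂ} (hV : IsStarNormal V) :
    IsStarNormal (toEuclideanCLM (n := n) (𝕜 := ℂ) V) := by
  refine ⟨?_⟩
  have h := hV.star_comm_self
  rw [Commute, SemiconjBy] at h ⊢
  rw [← map_star, ← map_mul, ← map_mul, h]

/-- **Resonance bound for normal matrices.**  For a normal complex matrix `V` (`Vᴴ V = V Vᴴ`) on a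
non-empty index type, every `μ ∈ ℂ` and every vector `x` of `EuclideanSpace ℂ n`, some root `z` of the
characteristic polynomial of `V` satisfies `‖μ − z‖ · ‖x‖ ≤ ‖μ • x − V x‖`. [folklore] -/
theorem normal_exists_root_charpoly_norm_mul_le [Nonempty n] {V : Matrix n n ℂ}
    (hV : IsStarNormal V) (μ : ℂ) (x : EuclideanSpace ℂ n) :
    ∃ z ∈ V.charpoly.roots, ‖μ - z‖ * ‖x‖ ≤ ‖μ • x - toEuclideanLin V x‖ := by
  classical
  have hsplit : V.charpoly.Splits := IsAlgClosed.splits _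
  have hcard : Multiset.card V.charpoly.roots = Fintype.card n := by
    rw [← hsplit.natDegree_eq_card_roots, Matrix.charpoly_natDegree_eq_dim]
  have hne : V.charpoly.roots.toFinset.Nonempty := by
    rw [Multiset.toFinset_nonempty, ← Multiset.card_pos, hcard]
    exact Fintype.card_pos
  obtain ⟨z₀, hz₀, hmin⟩ := V.charpoly.roots.toFinset.exists_min_image (fun z => ‖μ - z‖) hne
  refine ⟨z₀, Multiset.mem_toFinset.mp hz₀, ?_⟩
  have hspec : spectrum ℂ (toEuclideanCLM (n := n) (𝕜 := ℂ) V) = spectrum ℂ V :=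
    AlgEquiv.spectrum_eq _ V
  have hsep : ∀ z ∈ spectrum ℂ (toEuclideanCLM (n := n) (𝕜 := ℂ) V), ‖μ - z₀‖ ≤ ‖μ - z‖ := by
    intro z hz
    rw [hspec, Matrix.mem_spectrum_iff_isRoot_charpoly] at hz
    refine hmin z (Multiset.mem_toFinset.mpr ?_)
    exact (Polynomial.mem_roots V.charpoly_monic.ne_zero).mpr hz
  haveI := isStarNormal_toEuclideanCLM hV
  have h := normal_sep_mul_norm_le_norm_sub (T := toEuclideanCLM (n := n) (𝕜 := ℂ) V) μ
    (norm_nonneg _) hsep x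
  have hcoe : toEuclideanCLM (n := n) (𝕜 := ℂ) V x = toEuclideanLin V x := by
    rw [← coe_toEuclideanCLM_eq_toEuclideanLin]
    rfl
  rwa [hcoe] at h

/-- **Spectral variation for normal matrices** (the easy half of Bauer–Fike / Weyl for normal operators):
every eigenvalue of an arbitrary matrix `W` lies within `‖W − V‖` (the `ℓ²` operator norm) of the spectrum of
a NORMAL matrix `V`: for each root `λ` of `χ_W` there is a root `z` of `χ_V` with `‖λ − z‖ ≤ ‖W − V‖`
(Bhatia, *Matrix Analysis*, Thm. VI.3.3; Kato §V.4.3). [folklore] -/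
theorem normal_exists_root_charpoly_norm_sub_le [Nonempty n] {V : Matrix n n ℂ} (hV : IsStarNormal V)
    (W : Matrix n n ℂ) {lam : ℂ} (hlam : lam ∈ W.charpoly.roots) :
    ∃ z ∈ V.charpoly.roots, ‖lam - z‖ ≤ ‖W - V‖ := by
  classical
  -- an eigenvector of `W` for `lam`
  have hroot : W.charpoly.IsRoot lam := (Polynomial.mem_roots W.charpoly_monic.ne_zero).mp hlam
  have hdet : (Matrix.scalar n lam - W).det = 0 := by
    rw [← Matrix.eval_charpoly]; exact hroot
  obtain ⟨u, hu, hu0⟩ := Matrix.exists_mulVec_eq_zero_iff.mpr hdet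
  have h1 : W *ᵥ u = lam • u := by
    rw [Matrix.sub_mulVec, sub_eq_zero, Matrix.scalar_apply, ← Matrix.smul_one_eq_diagonal,
      Matrix.smul_mulVec, Matrix.one_mulVec] at hu0
    exact hu0.symm
  -- transport to `EuclideanSpace`
  set x : EuclideanSpace ℂ n := WithLp.toLp 2 u with hx
  have hxne : x ≠ 0 := by
    intro h0
    apply hu
    have h' : (WithLp.toLp 2 u : EuclideanSpace ℂ n).ofLp = (0 : EuclideanSpace ℂ n).ofLp := by
      rw [← hx, h0]
    simpa using h'
  have hxpos : 0 < ‖x‖ := norm_pos_iff.mpr hxne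
  obtain ⟨z, hz, hle⟩ := normal_exists_root_charpoly_norm_mul_le hV lam x
  refine ⟨z, hz, ?_⟩
  -- `lam • x - V x = (W - V) x` since `W x = lam • x`
  have eV : toEuclideanLin V x = WithLp.toLp 2 (V *ᵥ u) := rfl
  have hdiff : lam • x - toEuclideanLin V x = WithLp.toLp 2 ((W - V) *ᵥ u) := by
    rw [eV, hx, ← WithLp.toLp_smul, ← h1, ← WithLp.toLp_sub, Matrix.sub_mulVec]
  rw [hdiff] at hle
  have hop : ‖(WithLp.toLp 2 ((W - V) *ᵥ u) : EuclideanSpace ℂ n)‖ ≤ ‖W - V‖ * ‖x‖ :=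
    Matrix.l2_opNorm_mulVec (W - V) x
  have : ‖lam - z‖ * ‖x‖ ≤ ‖W - V‖ * ‖x‖ := hle.trans hop
  exact le_of_mul_le_mul_right this hxpos

end Literature.Analysis.InnerProduct

end
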